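import Mathlib.Analysis.Fourier.FiniteAbelian.PontryaginDuality
import Mathlib.Analysis.RCLike.Basic
import Mathlib.GroupTheory.Coset.Card
import Literature.NumberTheory.EllipticCurves.KohelShparlinskiCharacterSums
import HarnessLib

/-!
# Kohel–Shparlinski character sums: Corollary 1 from inequality (3) (the averaging step)

This is the first proof file towards the discharge of the named fact
`Literature.NumberTheory.EllipticCurves.KohelShparlinski.CoordinateCharSumBound`
(`KohelShparlinskiCharacterSums`). It formalises, verbatim, the one step of
[KohelShparlinski2000] that is pure finite-abelian-group harmonic analysis: the proof of
**Corollary 1** (p. 399) from the full-group inequality **(3)** (p. 399).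

For a subgroup `H ≤ E(𝔽_q)` the indicator of `H` is the average of the characters of `E(𝔽_q)`
that are trivial on `H`, i.e. of the characters of the quotient `E(𝔽_q)/H` pulled back to `E(𝔽_q)`:
`1_H(P) = 𝔼_{χ ∈ Hom(E(𝔽_q)/H, ℂ*)} χ(P̄)` (`expect_addChar_quotient_apply`). Hence
`S_H(ω, ψ, f) = 𝔼_χ S(ω · (χ ∘ π), ψ, f)` (`affineCharSum_eq_expect`), and a bound
`|S(ω', ψ, f)| ≤ B` valid for every character `ω'` of `E(𝔽_q)` gives `|S_H(ω, ψ, f)| ≤ B` for every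
subgroup `H` and every `ω` (`norm_affineCharSum_le_of_forall_top`) — exactly the sentence "average
(3) over the characters of `E(𝔽_q)/H`" of the source. Consequently the named fact is equivalent to
its full-group case (`coordinateCharSumBound_of_top`), which is inequality (3) for `f = x`
(`p ≠ 2`) and `f = y` (`p ≠ 3`); that case (Theorem 1: Bombieri–Weil) is the subject of the later
files of this series.

No definitions, no named facts: theorems only.

## References

* [KohelShparlinski2000] D. R. Kohel, I. E. Shparlinski, *On exponential sums and group generators
  for elliptic curves over finite fields*, ANTS-IV, LNCS 1838 (2000), 395–404 — Cor. 1 and its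
  proof, p. 399.
-/

noncomputable section

open Finset
open scoped BigOperators

namespace Literature.NumberTheory.EllipticCurves.KohelShparlinski

/-! ### Finite abelian groups: the indicator of a subgroup as an average of characters -/

section Indicator

variable {G : Type*} [AddCommGroup G] [Finite G]

/-- For a finite abelian group `G`, a subgroup `H` and `a ∈ G`: the average over the characters
`χ` of `G/H` of `χ(ā)` is `1` if `a ∈ H` and `0` otherwise (orthogonality of characters of the
finite abelian group `G/H`, Mathlib's `AddChar.expect_apply_eq_ite`, and `ā = 0 ↔ a ∈ H`).
[folklore] -/
theorem expect_addChar_quotient_apply (H : AddSubgroup G) (a : G) [Decidable (a ∈ H)] :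
    𝔼 χ : AddChar (G ⧸ H) ℂ, χ (a : G ⧸ H) = if a ∈ H then 1 else 0 := by
  classical
  rw [AddChar.expect_apply_eq_ite]
  by_cases ha : a ∈ H
  · rw [if_pos ((QuotientAddGroup.eq_zero_iff a).mpr ha), if_pos ha]
  · rw [if_neg (mt (QuotientAddGroup.eq_zero_iff a).mp ha), if_neg ha]

end Indicator

/-! ### The points of a Weierstrass curve over a finite field form a finite group -/

section Finite

variable {F : Type} [Field F] [Finite F]

/-- The group `W(F)` of points of a Weierstrass curve over a finite field is finite: it injects into
`Option (F × F)` (`O ↦ none`, `(x, y) ↦ some (x, y)`). (Also in the tree as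
`…BinaryQuarticFiniteFieldSolubilityProofs.finite_point`; reproved here to keep the imports of this
series minimal.) [folklore] -/
theorem finite_affinePoint (W : WeierstrassCurve F) : Finite W.toAffine.Point := by
  refine Finite.of_injective (fun P : W.toAffine.Point => match P with
    | .zero => (none : Option (F × F))
    | .some x y _ => some (x, y)) ?_
  intro P Q h
  rcases P with _ | ⟨x, y, hP⟩ <;> rcases Q with _ | ⟨x', y', hQ⟩
  · rfl
  · simp at h
  · simp at h
  · simp only [Option.some.injEq, Prod.mk.injEq] at h
    obtain ⟨rfl, rfl⟩ := h
    rfl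

end Finite

/-! ### Corollary 1 from (3): `S_H(ω, ψ, f)` is the average of `S(ω·(χ∘π), ψ, f)` over `χ ∈ (E/H)^` -/

section Average

variable {F : Type} [Field F] [Fintype F] [DecidableEq F]

/-- **The averaging identity behind [KohelShparlinski2000, Cor. 1].** For a subgroup
`H ≤ E(𝔽_q)`, a character `ω` of `E(𝔽_q)`, an additive character `ψ` and a coordinate function
`f`: `S_H(ω, ψ, f) = 𝔼_{χ ∈ Hom(E(𝔽_q)/H, ℂ*)} S(ω · (χ ∘ π), ψ, f)`, where `π : E(𝔽_q) → E(𝔽_q)/H`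
is the projection and `S = S_{E(𝔽_q)}` is the full-group sum (insert
`1_H(P) = 𝔼_χ χ(π P)` and exchange the sums). The instance binder `[Finite E(𝔽_q)]` (needed to
write the average) is always available as `finite_affinePoint W`.
[cite: KohelShparlinski2000, proof of Cor. 1 p. 399] -/
theorem affineCharSum_eq_expect (W : WeierstrassCurve F) [Finite W.toAffine.Point]
    (H : AddSubgroup W.toAffine.Point) (ω : AddChar W.toAffine.Point ℂ) (ψ : AddChar F ℂ)
    (f : F → F → F) :
    affineCharSum W H ω ψ f =
      𝔼 χ : AddChar (W.toAffine.Point ⧸ H) ℂ,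
        affineCharSum W ⊤ (ω * χ.compAddMonoidHom (QuotientAddGroup.mk' H)) ψ f := by
  classical
  unfold affineCharSum
  rw [Finset.expect_sum_comm]
  refine Finset.sum_congr rfl fun xy _ => ?_
  by_cases h : W.toAffine.Nonsingular xy.1 xy.2
  · simp only [h, ↓reduceDIte, AddSubgroup.mem_top, ↓reduceIte, AddChar.mul_apply,
      AddChar.compAddMonoidHom_apply, QuotientAddGroup.mk'_apply]
    rw [← boole_mul,
      ← expect_addChar_quotient_apply H (WeierstrassCurve.Affine.Point.some xy.1 xy.2 h),
      Finset.expect_mul]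
    refine Finset.expect_congr rfl fun χ _ => ?_
    ring
  · simp only [h, ↓reduceDIte]
    exact (Finset.expect_eq_zero fun _ _ => rfl).symm

/-- **Corollary 1 from inequality (3), abstract form.** If `|S(ω', ψ, f)| ≤ B` for every character
`ω'` of `E(𝔽_q)` (the full-group bound (3) of the source), then `|S_H(ω, ψ, f)| ≤ B` for every
subgroup `H ≤ E(𝔽_q)` and every character `ω`: by `affineCharSum_eq_expect`, `S_H(ω, ψ, f)` is an
average of numbers of modulus `≤ B`. [cite: KohelShparlinski2000, Cor. 1 p. 399] -/
theorem norm_affineCharSum_le_of_forall_top (W : WeierstrassCurve F)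
    (H : AddSubgroup W.toAffine.Point) (ω : AddChar W.toAffine.Point ℂ) (ψ : AddChar F ℂ)
    (f : F → F → F) {B : ℝ}
    (hB : ∀ ω' : AddChar W.toAffine.Point ℂ, ‖affineCharSum W ⊤ ω' ψ f‖ ≤ B) :
    ‖affineCharSum W H ω ψ f‖ ≤ B := by
  haveI := finite_affinePoint W
  rw [affineCharSum_eq_expect]
  refine (RCLike.norm_expect_le (K := ℂ) (E := ℂ)).trans ?_
  refine Finset.expect_le Finset.univ_nonempty fun χ _ => ?_
  exact hB _

/-- **The named fact reduces to its full-group case** (inequality (3) of the source for `f = x`,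
`p ≠ 2`, and `f = y`, `p ≠ 3`, twisted by an arbitrary character of `E(𝔽_q)`): if for every finite
field, every elliptic curve, every character `ω` of `E(𝔽_q)` and every nontrivial `ψ` one has
`|S(ω, ψ, x)| ≤ 4√q` (`p ≠ 2`) and `|S(ω, ψ, y)| ≤ 6√q` (`p ≠ 3`), then `CoordinateCharSumBound`
holds. This is the source's derivation of Corollary 1 from Theorem 1/(3); the hypothesis is what the
remaining files of this series establish (Bombieri–Weil).
[cite: KohelShparlinski2000, Cor. 1 p. 399] -/
theorem coordinateCharSumBound_of_top
    (h3 : ∀ {F : Type} [Field F] [Fintype F] [DecidableEq F] (W : WeierstrassCurve F)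
      [W.IsElliptic] (ω : AddChar W.toAffine.Point ℂ) (ψ : AddChar F ℂ), ψ ≠ 0 →
        (ringChar F ≠ 2 →
          ‖affineCharSum W ⊤ ω ψ (fun x _ => x)‖ ≤ 4 * Real.sqrt (Fintype.card F)) ∧
        (ringChar F ≠ 3 →
          ‖affineCharSum W ⊤ ω ψ (fun _ y => y)‖ ≤ 6 * Real.sqrt (Fintype.card F))) :
    CoordinateCharSumBound := by
  intro F _ _ _ W _ H ω ψ hψ
  exact ⟨fun hp => norm_affineCharSum_le_of_forall_top W H ω ψ _ fun ω' => (h3 W ω' ψ hψ).1 hp,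
    fun hp => norm_affineCharSum_le_of_forall_top W H ω ψ _ fun ω' => (h3 W ω' ψ hψ).2 hp⟩

end Average

end Literature.NumberTheory.EllipticCurves.KohelShparlinski
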